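import Summits.NavierStokesRegularity.FunctionalMining.VelocityWeightedBalanceC1
import HarnessLib

/-!
# FunctionalMining — the exact `U_s = ∫|u|^s` balance for real `s ≥ 2` and its slice form for `s > 2`

Search for candidate a priori estimates; no regularity claim. Cell `pub-nsfunc`, prove seat
(gen 10). The dynamic half of the K0 rows `EV.s|T_LD|G1` at a REAL exponent `s` (SIEVELD §3.5;
`U_s = ∫|u|^s = ∫ (|u|²)^{s/2}`), Robinson–Rodrigo–Sadowski 2016 Ex. 11.1–11.4 at `α = s`:

* `VelocityMoment.hasDerivWithinAt_integral_normSq_rpow` — along a classical solution of the forced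
  system on `T^d × [a, b]`, for real `s ≥ 2` (the weight `r ↦ r^{s/2}` is `C¹`):
  `dU_s/dt = sν∫(|u|²)^{s/2−1}⟪u, Δu⟫ − s∫(|u|²)^{s/2−1}⟪u, ∇p⟫ + s∫(|u|²)^{s/2−1}⟪u, f⟫`, and
  `…_unforced` (`f = 0`).
* `VelocityMoment.integral_rpow_mul_inner_laplacian_le` — the viscous sign at a real exponent:
  for smooth `v` and `r > 0`, `∫ (|v|²)^r ⟪v, Δv⟫ ≤ −∫ (|v|²)^r ∑ₖ‖∂ₖv‖²` (the smooth-weight identity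
  `integral_deriv_comp_normSq_mul_inner_laplacian` at `g_ε(r') = (r'+ε)^{r+1}/(r+1)`, second term
  `−½∫ r(|v|²+ε)^{r−1}|∇|v|²|² ≤ 0`, and `ε → 0⁺`).
* `VelocityMoment.derivWithin_Us_le` — the slice form for real `s > 2`, `ν ≥ 0`, `f = 0`:
  `dU_s/dt ≤ −sν∫(|u|²)^{s/2−1}∑ₖ‖∂ₖu‖² − s∫(|u|²)^{s/2−1}⟪u, ∇p⟫`.
-/

noncomputable section

open MeasureTheory Finset Set Filter Topology
open scoped InnerProductSpace RealInnerProductSpace ContDiff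

namespace Summit.NavierStokesRegularity.FunctionalMining

open Literature.Analysis.FunctionSpaces Literature.Analysis.FluidPDE

namespace VelocityMoment

variable {d : Type*} [Fintype d] [DecidableEq d]

/-! ## 1. The exact balance with the weight `r ↦ r^{s/2}`, real `s ≥ 2` -/

/-- **Exact `U_s` balance, real `s ≥ 2`, forced system.** Along a classical solution of
`∂ₜu + (u·∇)u = νΔu − ∇p + f`, `div u = 0` on `T^d × [a, b]` (`a < b`), `r ↦ ∫ (|u(r)|²)^{s/2}` has,
at every `t ∈ [a, b]`, the one-sided derivative
`sν∫(|u|²)^{s/2−1}⟪u, Δu⟫ − s∫(|u|²)^{s/2−1}⟪u, ∇p⟫ + s∫(|u|²)^{s/2−1}⟪u, f⟫` within `[a, b]`.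
[cite: RobinsonRodrigoSadowski2016, Ch. 11 Exercise 11.4 eq. (11.19)] -/
theorem hasDerivWithinAt_integral_normSq_rpow
    {a b ν : ℝ} {f u : ℝ → UnitAddTorus d → EuclideanSpace ℝ d} {p : ℝ → UnitAddTorus d → ℝ}
    (h : Torus.IsClassicalNSSolutionOn (Icc a b) ν f u p) (hab : a < b) {s : ℝ} (hs : 2 ≤ s)
    {t : ℝ} (ht : t ∈ Icc a b) :
    HasDerivWithinAt (fun r => ∫ x, (‖u r x‖ ^ 2) ^ (s / 2))
      (s * ν * (∫ x, (‖u t x‖ ^ 2) ^ (s / 2 - 1) * ⟪u t x, Torus.laplacian (u t) x⟫) -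
        s * (∫ x, (‖u t x‖ ^ 2) ^ (s / 2 - 1) * ⟪u t x, Torus.gradient (p t) x⟫) +
        s * ∫ x, (‖u t x‖ ^ 2) ^ (s / 2 - 1) * ⟪u t x, f t x⟫)
      (Icc a b) t := by
  have hp1 : (1 : ℝ) ≤ s / 2 := by linarith
  have hΨ : ContDiffOn ℝ 1 (fun y : ℝ => y ^ (s / 2)) univ :=
    (Real.contDiff_rpow_const_of_le (p := s / 2) (n := 1) (by exact_mod_cast hp1)).contDiffOn
  have hd : ∀ y : ℝ, deriv (fun y : ℝ => y ^ (s / 2)) y = s / 2 * y ^ (s / 2 - 1) := fun y =>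
    (Real.hasDerivAt_rpow_const (p := s / 2) (Or.inr hp1)).deriv
  have hD := hasDerivWithinAt_integral_comp_normSq_of_contDiffOn_one h hab isOpen_univ hΨ
    (fun _ _ _ => mem_univ _) ht
  refine hD.congr_deriv ?_
  simp only [hd]
  have e1 : ∀ g : UnitAddTorus d → ℝ,
      (∫ x, s / 2 * (‖u t x‖ ^ 2) ^ (s / 2 - 1) * g x) =
        s / 2 * ∫ x, (‖u t x‖ ^ 2) ^ (s / 2 - 1) * g x := by
    intro g
    rw [← integral_const_mul]
    exact integral_congr_ae (ae_of_all _ fun x => by ring)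
  rw [e1, e1, e1]
  ring

/-- **Unforced case, real `s ≥ 2`**: along a classical solution of the unforced system (`f = 0`),
`r ↦ ∫ (|u(r)|²)^{s/2}` has the one-sided derivative
`sν∫(|u|²)^{s/2−1}⟪u, Δu⟫ − s∫(|u|²)^{s/2−1}⟪u, ∇p⟫` within `[a, b]`.
[cite: RobinsonRodrigoSadowski2016, Ch. 11 Exercise 11.4 eq. (11.19)] -/
theorem hasDerivWithinAt_integral_normSq_rpow_unforced
    {a b ν : ℝ} {u : ℝ → UnitAddTorus d → EuclideanSpace ℝ d} {p : ℝ → UnitAddTorus d → ℝ}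
    (h : Torus.IsClassicalNSSolutionOn (Icc a b) ν 0 u p) (hab : a < b) {s : ℝ} (hs : 2 ≤ s)
    {t : ℝ} (ht : t ∈ Icc a b) :
    HasDerivWithinAt (fun r => ∫ x, (‖u r x‖ ^ 2) ^ (s / 2))
      (s * ν * (∫ x, (‖u t x‖ ^ 2) ^ (s / 2 - 1) * ⟪u t x, Torus.laplacian (u t) x⟫) -
        s * ∫ x, (‖u t x‖ ^ 2) ^ (s / 2 - 1) * ⟪u t x, Torus.gradient (p t) x⟫)
      (Icc a b) t := by
  have hD := hasDerivWithinAt_integral_normSq_rpow h hab hs ht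
  refine hD.congr_deriv ?_
  have h0 : ∀ x, ⟪u t x, (0 : ℝ → UnitAddTorus d → EuclideanSpace ℝ d) t x⟫ = 0 := by
    intro x; simp
  simp only [h0, mul_zero, integral_zero, add_zero]

/-! ## 2. The viscous term at a real exponent -/

omit [DecidableEq d] in
/-- Continuity of `ε ↦ ∫_{T^d} F(ε, x) dx` for jointly continuous `F`. [folklore] -/
private theorem continuous_integral_param_vel {F : ℝ → UnitAddTorus d → ℝ}
    (hF : Continuous (Function.uncurry F)) : Continuous fun ε => ∫ x, F ε x := by
  have h := continuous_parametric_integral_of_continuous (μ := volume) hF isCompact_univ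
  simpa only [Measure.restrict_univ] using h

omit [Fintype d] [DecidableEq d] in
/-- Passing to `ε → 0⁺` in `0 ≤ φ ε` (`0 < ε ≤ 1`) with `φ` continuous at `0`. [folklore] -/
private theorem nonneg_of_forall_pos_of_continuousAt_vel {φ : ℝ → ℝ} (hφ : ContinuousAt φ 0)
    (h : ∀ ε : ℝ, 0 < ε → ε ≤ 1 → 0 ≤ φ ε) : 0 ≤ φ 0 := by
  have ht : Tendsto φ (𝓝[>] 0) (𝓝 (φ 0)) := hφ.tendsto.mono_left nhdsWithin_le_nhds
  refine ge_of_tendsto ht ?_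
  have hmem : Ioo (0 : ℝ) 1 ∈ 𝓝[>] (0 : ℝ) := Ioo_mem_nhdsGT one_pos
  filter_upwards [hmem] with ε hε using h ε hε.1 hε.2.le

/-- **Sign of the viscous term of the `U_s` balance at a real exponent** (Robinson–Rodrigo–Sadowski
2016, Exercise 11.1 `∫ −Δu·u|u|^{α−2} ≥ ∫|∇u|²|u|^{α−2}`, real `α`): for smooth `v` on `T^d` and
`r > 0`, `∫ (|v|²)^r ⟪v, Δv⟫ ≤ −∫ (|v|²)^r ∑ₖ‖∂ₖv‖²` — the smooth-weight identity
`integral_deriv_comp_normSq_mul_inner_laplacian` at `g_ε(y) = (y+ε)^{r+1}/(r+1)` on `Ioi (−ε)`,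
whose second term `−½∫ r(|v|²+ε)^{r−1}∑ₖ(∂ₖ|v|²)²` is nonpositive, and `ε → 0⁺`.
[cite: RobinsonRodrigoSadowski2016, Ch. 11 Exercise 11.1] -/
theorem integral_rpow_mul_inner_laplacian_le {v : UnitAddTorus d → EuclideanSpace ℝ d}
    (hv : Torus.IsSmooth v) {r : ℝ} (hr : 0 < r) :
    ∫ x, (‖v x‖ ^ 2) ^ r * ⟪v x, Torus.laplacian v x⟫ ≤
      -∫ x, (‖v x‖ ^ 2) ^ r * ∑ k, ‖Torus.partialDeriv k v x‖ ^ 2 := by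
  have hQs : Torus.IsSmooth (fun y => ‖v y‖ ^ 2) := hv.norm_sq
  have hQ : Continuous (fun y => ‖v y‖ ^ 2) := hQs.continuous
  have hQ0 : ∀ x, 0 ≤ ‖v x‖ ^ 2 := fun x => sq_nonneg _
  set h₁ : UnitAddTorus d → ℝ := fun x => ⟪v x, Torus.laplacian v x⟫ with hh₁
  set h₂ : UnitAddTorus d → ℝ := fun x => ∑ k, ‖Torus.partialDeriv k v x‖ ^ 2 with hh₂
  have hc₁ : Continuous h₁ := (hv.inner hv.laplacian).continuous
  have hc₂ : Continuous h₂ := continuous_finsetSum _ fun k _ =>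
    (hv.partialDeriv k).continuous.norm.pow 2
  -- the parametric integrals
  set F : ℝ → ℝ := fun ε => ∫ x, (‖v x‖ ^ 2 + ε) ^ r * h₁ x with hF
  set G : ℝ → ℝ := fun ε => ∫ x, (‖v x‖ ^ 2 + ε) ^ r * h₂ x with hG
  have hpow : Continuous fun q : ℝ × UnitAddTorus d => (‖v q.2‖ ^ 2 + q.1) ^ r :=
    ((hQ.comp continuous_snd).add continuous_fst).rpow_const fun q => Or.inr hr.le
  have hFc : Continuous F := continuous_integral_param_vel (hpow.mul (hc₁.comp continuous_snd))
  have hGc : Continuous G := continuous_integral_param_vel (hpow.mul (hc₂.comp continuous_snd))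
  -- the identity at `ε > 0`
  have hε : ∀ ε : ℝ, 0 < ε → ε ≤ 1 → 0 ≤ -G ε - F ε := by
    intro ε hε _
    set g : ℝ → ℝ := fun y => (y + ε) ^ (r + 1) / (r + 1) with hg
    have hr1 : (1 : ℝ) ≤ r + 1 := by linarith
    have hpos : ∀ x, 0 < ‖v x‖ ^ 2 + ε := fun x => by linarith [hQ0 x]
    have hU : IsOpen (Ioi (-ε)) := isOpen_Ioi
    have hmaps : ∀ x, ‖v x‖ ^ 2 ∈ Ioi (-ε) := fun x => by
      show -ε < ‖v x‖ ^ 2; linarith [hQ0 x]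
    have hgs : ContDiffOn ℝ ∞ g (Ioi (-ε)) := by
      intro y hy
      have hy' : y + ε ≠ 0 := by
        have : -ε < y := hy
        linarith
      exact (((contDiffAt_id.add contDiffAt_const).rpow_const_of_ne hy').div_const _).contDiffWithinAt
    have hd1 : deriv g = fun y => (y + ε) ^ r := by
      funext y
      have h := ((hasDerivAt_id' y).add_const ε).rpow_const (p := r + 1) (Or.inr hr1)
      have h' : HasDerivAt g ((1 * (r + 1) * (y + ε) ^ (r + 1 - 1)) / (r + 1)) y := h.div_const _
      rw [h'.deriv, add_sub_cancel_right]
      have hr1' : r + 1 ≠ 0 := by linarith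
      field_simp
    have hd2 : ∀ y : ℝ, 0 < y + ε → deriv (deriv g) y = r * (y + ε) ^ (r - 1) := by
      intro y hy
      rw [hd1]
      have h := ((hasDerivAt_id' y).add_const ε).rpow_const (p := r) (Or.inl hy.ne')
      rw [h.deriv]; ring
    have hid := integral_deriv_comp_normSq_mul_inner_laplacian hv hU hgs hmaps
    rw [hd1] at hid
    have hB : 0 ≤ ∫ x, deriv (fun y => (y + ε) ^ r) (‖v x‖ ^ 2) *
        ∑ k, Torus.partialDeriv k (fun y => ‖v y‖ ^ 2) x ^ 2 := by
      refine integral_nonneg fun x => ?_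
      have e : deriv (fun y => (y + ε) ^ r) (‖v x‖ ^ 2) = r * (‖v x‖ ^ 2 + ε) ^ (r - 1) := by
        have := hd2 (‖v x‖ ^ 2) (hpos x)
        rwa [hd1] at this
      rw [e]
      exact mul_nonneg (mul_nonneg hr.le (Real.rpow_nonneg (hpos x).le _))
        (Finset.sum_nonneg fun k _ => sq_nonneg _)
    have hFε : F ε = ∫ x, (‖v x‖ ^ 2 + ε) ^ r * h₁ x := rfl
    have hGε : G ε = ∫ x, (‖v x‖ ^ 2 + ε) ^ r * h₂ x := rfl
    rw [hFε, hGε]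
    simp only [hh₁, hh₂]
    have h2 : (0 : ℝ) < 2⁻¹ := by norm_num
    nlinarith [hid, hB]
  -- `ε → 0⁺`
  have hφ : ContinuousAt (fun ε => -G ε - F ε) 0 := (hGc.neg.sub hFc).continuousAt
  have h0 := nonneg_of_forall_pos_of_continuousAt_vel hφ hε
  have hF0 : F 0 = ∫ x, (‖v x‖ ^ 2) ^ r * h₁ x := by simp only [hF, add_zero]
  have hG0 : G 0 = ∫ x, (‖v x‖ ^ 2) ^ r * h₂ x := by simp only [hG, add_zero]
  simp only [hF0, hG0, hh₁, hh₂] at h0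
  linarith

/-! ## 3. The slice form of the `U_s` balance, real `s > 2` -/

/-- **Slice form of the `U_s` balance, real `s > 2`** (`hasDerivWithinAt_integral_normSq_rpow_unforced`
+ the viscous sign at `r = s/2 − 1 > 0`): along a classical solution of the unforced system on
`[a, b] × T^d` with `ν ≥ 0`, `r ↦ U_s(r) = ∫(|u(r)|²)^{s/2}` is differentiable within `[a, b]` at
`t` and `dU_s/dt ≤ −sν∫(|u|²)^{s/2−1}∑ₖ‖∂ₖu‖² − s∫(|u|²)^{s/2−1}⟪u, ∇p⟫`.
[cite: RobinsonRodrigoSadowski2016, Ch. 11 Exercise 11.4 eq. (11.19)] -/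
theorem derivWithin_Us_le {a b ν : ℝ} (hab : a < b) (hν : 0 ≤ ν)
    {u : ℝ → UnitAddTorus d → EuclideanSpace ℝ d} {p : ℝ → UnitAddTorus d → ℝ}
    (hsol : Torus.IsClassicalNSSolutionOn (Icc a b) ν 0 u p) {s : ℝ} (hs : 2 < s) {t : ℝ}
    (ht : t ∈ Icc a b) :
    DifferentiableWithinAt ℝ (fun r => ∫ x, (‖u r x‖ ^ 2) ^ (s / 2)) (Icc a b) t ∧
      derivWithin (fun r => ∫ x, (‖u r x‖ ^ 2) ^ (s / 2)) (Icc a b) t ≤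
        -(s * ν * ∫ x, (‖u t x‖ ^ 2) ^ (s / 2 - 1) * ∑ k, ‖Torus.partialDeriv k (u t) x‖ ^ 2) -
          s * ∫ x, (‖u t x‖ ^ 2) ^ (s / 2 - 1) * ⟪u t x, Torus.gradient (p t) x⟫ := by
  have hut : Torus.IsSmooth (u t) := hsol.smooth_velocity.isSmooth_slice ht
  have hD := hasDerivWithinAt_integral_normSq_rpow_unforced hsol hab hs.le ht
  have hUD : UniqueDiffWithinAt ℝ (Icc a b) t := uniqueDiffOn_Icc hab t ht
  refine ⟨hD.differentiableWithinAt, ?_⟩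
  rw [hD.derivWithin hUD]
  have hr : 0 < s / 2 - 1 := by linarith
  have hV := integral_rpow_mul_inner_laplacian_le hut hr
  obtain ⟨I, hI⟩ : ∃ I : ℝ, I = ∫ x, (‖u t x‖ ^ 2) ^ (s / 2 - 1) *
      ∑ k, ‖Torus.partialDeriv k (u t) x‖ ^ 2 := ⟨_, rfl⟩
  obtain ⟨V, hVdef⟩ : ∃ V : ℝ, V = ∫ x, (‖u t x‖ ^ 2) ^ (s / 2 - 1) *
      ⟪u t x, Torus.laplacian (u t) x⟫ := ⟨_, rfl⟩
  rw [← hI, ← hVdef] at hV ⊢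
  have hs0 : 0 ≤ s * ν := by nlinarith
  nlinarith [mul_le_mul_of_nonneg_left hV hs0]

end VelocityMoment

end Summit.NavierStokesRegularity.FunctionalMining
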